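import Summits.NavierStokesRegularity.NavierStokesRegularity.Theorems.HubbleDynamoNoSelfExcitedDynamoFarFieldRung
import Literature.Analysis.FluidPDE.NewtonPotentialHolder
import HarnessLib

/-!
# Crux `NoSelfExcitedDynamo` (stmt-NavierStokesRegularity-1934), line `registered`:
# the far-field rung, pointwise form — the crux holds for every solution with one slice that is
# `o(1/|x|)` at spatial infinity

Theorems file (`--supports stmt-NavierStokesRegularity-1934`; theorems only, sorry-free), companion of
`HubbleDynamoNoSelfExcitedDynamoFarFieldRung.lean` (`farFieldRung`: one slice with trivial blow-down
`λu(t₀)(λ·) ⇀ 0` ⇒ a.e.-zero slices; Albritton–Barker 2019, Thm 4.1, tree theorem).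

* `farFieldRung_blowdown_of_littleO` — if `‖x‖‖g(x)‖ ≤ C` and `‖x‖‖g(x)‖ → 0` as `‖x‖ → ∞` then the
  blow-down of `g` is trivial: on `‖x‖ < δ` the integrand of `∫⟪λg(λx), φ(x)⟫dx` is at most
  `C‖φ‖_∞/‖x‖` (integral `(3/2)|B₁|C‖φ‖_∞δ²`, `NewtonPotentialHolder.integral_ball_norm_rpow_neg`),
  on `‖x‖ ≥ δ` at most `(ε/δ)‖φ(x)‖` once `λδ ≥ R(ε)`.
* `farFieldRung_of_littleOSlice` — the `o(1/|x|)` RUNG: a bounded ancient mild solution with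
  measurable slices, the pointwise Type-I bound and ONE slice with `‖x‖‖u(t₀, x)‖ → 0` at spatial
  infinity has a.e.-zero slices. Contrapositive (portrait of a counterexample to the crux):
  `limsup_{‖x‖→∞} ‖x‖‖u(t, x)‖ > 0` at EVERY time — the Type-I tail `C/‖x‖` is genuinely present.
-/

noncomputable section

-- the mandated stub namespace repeats `NavierStokesRegularity` (tree precedent for this crux's stubs)
set_option linter.dupNamespace false

namespace Summit.NavierStokesRegularity.NavierStokesRegularity.Theorems.NoSelfExcitedDynamo.Registered

open Set MeasureTheory Filter Topology InnerProductSpace Function Metric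
open scoped RealInnerProductSpace NNReal ENNReal ContDiff
open Literature.Analysis Literature.Analysis.FluidPDE

/-! ### A slice that is `o(1/|x|)` at spatial infinity has trivial blow-down -/

/-- **Pointwise decay faster than `1/|x|` kills the blow-down**: if `‖x‖‖g(x)‖ ≤ C` everywhere and
`‖x‖‖g(x)‖ → 0` as `‖x‖ → ∞`, then `∫ ⟪λ g(λx), φ(x)⟫ dx → 0` as `λ → +∞` for every test field `φ`:
on `‖x‖ < δ` the integrand is at most `C‖φ‖_∞/‖x‖` (integral `(3/2)|B₁| C‖φ‖_∞ δ²`), and on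
`‖x‖ ≥ δ` it is at most `(ε/δ)‖φ(x)‖` as soon as `λδ ≥ R(ε)`. -/
theorem farFieldRung_blowdown_of_littleO
    {g : EuclideanSpace ℝ (Fin 3) → EuclideanSpace ℝ (Fin 3)} {C : ℝ} (hC : ∀ x, ‖x‖ * ‖g x‖ ≤ C)
    (ho : ∀ ε : ℝ, 0 < ε → ∃ R : ℝ, ∀ x, R ≤ ‖x‖ → ‖x‖ * ‖g x‖ ≤ ε)
    {φ : EuclideanSpace ℝ (Fin 3) → EuclideanSpace ℝ (Fin 3)}
    (hφ : FunctionSpaces.IsTestFunctionOn (⊤ : TopologicalSpace.Opens (EuclideanSpace ℝ (Fin 3))) φ) :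
    Tendsto (fun lam : ℝ => ∫ x, ⟪lam • g (lam • x), φ x⟫) atTop (𝓝 0) := by
  have hφc : Continuous φ := hφ.contDiff.continuous
  have hφi : Integrable φ := hφc.integrable_of_hasCompactSupport hφ.hasCompactSupport
  obtain ⟨Mφ, hMφ⟩ := hφc.bounded_above_of_compact_support hφ.hasCompactSupport
  have hC0 : 0 ≤ C := le_trans (mul_nonneg (norm_nonneg _) (norm_nonneg _)) (hC 0)
  have hMφ0 : 0 ≤ Mφ := (norm_nonneg _).trans (hMφ 0)
  obtain ⟨A, hA⟩ : ∃ A : ℝ, A = 3 * (volume : Measure (EuclideanSpace ℝ (Fin 3))).real (ball 0 1) / 2 :=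
    ⟨_, rfl⟩
  have hA0 : 0 ≤ A := by rw [hA]; positivity
  obtain ⟨I₁, hI₁⟩ : ∃ I₁ : ℝ, I₁ = ∫ x, ‖φ x‖ := ⟨_, rfl⟩
  have hI₁0 : 0 ≤ I₁ := by rw [hI₁]; exact integral_nonneg fun x => norm_nonneg _
  refine Metric.tendsto_atTop.2 fun η hη => ?_
  -- the inner radius `δ` with `C Mφ A δ² ≤ η/4`
  obtain ⟨δ, hδ⟩ : ∃ δ : ℝ, δ = min 1 (η / (4 * (C * Mφ * A + 1))) := ⟨_, rfl⟩
  have hδ0 : 0 < δ := by rw [hδ]; exact lt_min one_pos (by positivity)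
  have hδ1 : δ ≤ 1 := by rw [hδ]; exact min_le_left _ _
  have hδη : C * Mφ * A * δ ^ 2 ≤ η / 4 := by
    have h1 : δ ≤ η / (4 * (C * Mφ * A + 1)) := by rw [hδ]; exact min_le_right _ _
    have hP : 0 ≤ C * Mφ * A := by positivity
    calc C * Mφ * A * δ ^ 2 = (C * Mφ * A * δ) * δ := by ring
      _ ≤ (C * Mφ * A * (η / (4 * (C * Mφ * A + 1)))) * 1 :=
          mul_le_mul (mul_le_mul_of_nonneg_left h1 hP) hδ1 hδ0.le (by positivity)
      _ = η / 4 * (C * Mφ * A / (C * Mφ * A + 1)) := by field_simp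
      _ ≤ η / 4 * 1 := by
          refine mul_le_mul_of_nonneg_left ?_ (by positivity)
          rw [div_le_one (by positivity)]; linarith
      _ = η / 4 := mul_one _
  -- the outer smallness `ε` and the threshold `λ ≥ R/δ`
  obtain ⟨ε, hε⟩ : ∃ ε : ℝ, ε = η * δ / (4 * (I₁ + 1)) := ⟨_, rfl⟩
  have hε0 : 0 < ε := by rw [hε]; positivity
  obtain ⟨R, hR⟩ := ho ε hε0
  refine ⟨max 1 (R / δ), fun lam hlam => ?_⟩
  have hlam1 : 1 ≤ lam := le_trans (le_max_left _ _) hlam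
  have hlam0 : 0 < lam := one_pos.trans_le hlam1
  have hlamR : R ≤ lam * δ := by
    have := le_trans (le_max_right _ _) hlam
    rwa [div_le_iff₀ hδ0] at this
  -- the integrable majorant
  obtain ⟨b, hb⟩ : ∃ b : EuclideanSpace ℝ (Fin 3) → ℝ, b = fun x =>
    (ball (0 : EuclideanSpace ℝ (Fin 3)) δ).indicator (fun x => C * Mφ * ‖x‖ ^ (-(1 : ℝ))) x +
      ε / δ * ‖φ x‖ := ⟨_, rfl⟩
  have hbi : Integrable b := by
    rw [hb]
    refine Integrable.add ?_ (hφi.norm.const_mul _)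
    exact (integrable_indicator_iff measurableSet_ball).2
      ((NewtonPotentialHolder.integrableOn_ball_norm_rpow_neg (s := 1) (by norm_num) δ).const_mul (C * Mφ))
  have hae : ∀ᵐ x ∂(volume : Measure (EuclideanSpace ℝ (Fin 3))), ‖⟪lam • g (lam • x), φ x⟫‖ ≤ b x := by
    have h0 : ∀ᵐ x ∂(volume : Measure (EuclideanSpace ℝ (Fin 3))), x ≠ 0 := by
      simp [ae_iff]
    filter_upwards [h0] with x hx
    have hxpos : 0 < ‖x‖ := norm_pos_iff.2 hx
    have h1 : ‖⟪lam • g (lam • x), φ x⟫‖ ≤ lam * ‖g (lam • x)‖ * ‖φ x‖ := by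
      calc ‖⟪lam • g (lam • x), φ x⟫‖ ≤ ‖lam • g (lam • x)‖ * ‖φ x‖ := norm_inner_le_norm _ _
        _ = lam * ‖g (lam • x)‖ * ‖φ x‖ := by rw [norm_smul, Real.norm_of_nonneg hlam0.le]
    -- `λ |g(λx)| = |λx| |g(λx)| / |x|`
    have hkey : lam * ‖g (lam • x)‖ = ‖lam • x‖ * ‖g (lam • x)‖ / ‖x‖ := by
      rw [norm_smul, Real.norm_of_nonneg hlam0.le]; field_simp
    have hind0 : 0 ≤ (ball (0 : EuclideanSpace ℝ (Fin 3)) δ).indicator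
        (fun x => C * Mφ * ‖x‖ ^ (-(1 : ℝ))) x := by
      refine Set.indicator_nonneg (fun y _ => ?_) x
      exact mul_nonneg (mul_nonneg hC0 hMφ0) (Real.rpow_nonneg (norm_nonneg _) _)
    have hsec0 : 0 ≤ ε / δ * ‖φ x‖ := mul_nonneg (div_nonneg hε0.le hδ0.le) (norm_nonneg _)
    have hbx : b x = (ball (0 : EuclideanSpace ℝ (Fin 3)) δ).indicator
        (fun x => C * Mφ * ‖x‖ ^ (-(1 : ℝ))) x + ε / δ * ‖φ x‖ := by rw [hb]
    by_cases hxδ : ‖x‖ < δ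
    · -- inner region: `λ|g(λx)||φ(x)| ≤ C Mφ / |x|`
      have hxball : x ∈ ball (0 : EuclideanSpace ℝ (Fin 3)) δ := mem_ball_zero_iff.2 hxδ
      have h2 : lam * ‖g (lam • x)‖ ≤ C / ‖x‖ := by
        rw [hkey]; exact div_le_div_of_nonneg_right (hC _) hxpos.le
      calc ‖⟪lam • g (lam • x), φ x⟫‖ ≤ lam * ‖g (lam • x)‖ * ‖φ x‖ := h1
        _ ≤ C / ‖x‖ * Mφ := mul_le_mul h2 (hMφ x) (norm_nonneg _) (div_nonneg hC0 hxpos.le)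
        _ = C * Mφ * ‖x‖ ^ (-(1 : ℝ)) := by rw [Real.rpow_neg_one]; ring
        _ = (ball (0 : EuclideanSpace ℝ (Fin 3)) δ).indicator (fun x => C * Mφ * ‖x‖ ^ (-(1 : ℝ))) x := by
            rw [indicator_of_mem hxball]
        _ ≤ b x := by rw [hbx]; exact le_add_of_nonneg_right hsec0
    · -- outer region: `|λx| ≥ λδ ≥ R`, so `λ|g(λx)| ≤ ε/|x| ≤ ε/δ`
      push Not at hxδ
      have hfar : R ≤ ‖lam • x‖ := by
        rw [norm_smul, Real.norm_of_nonneg hlam0.le]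
        exact hlamR.trans (mul_le_mul_of_nonneg_left hxδ hlam0.le)
      have h2 : lam * ‖g (lam • x)‖ ≤ ε / δ := by
        rw [hkey]
        calc ‖lam • x‖ * ‖g (lam • x)‖ / ‖x‖ ≤ ε / ‖x‖ := div_le_div_of_nonneg_right (hR _ hfar) hxpos.le
          _ ≤ ε / δ := div_le_div_of_nonneg_left hε0.le hδ0 hxδ
      calc ‖⟪lam • g (lam • x), φ x⟫‖ ≤ lam * ‖g (lam • x)‖ * ‖φ x‖ := h1
        _ ≤ ε / δ * ‖φ x‖ := mul_le_mul_of_nonneg_right h2 (norm_nonneg _)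
        _ ≤ b x := by rw [hbx]; exact le_add_of_nonneg_left hind0
  -- integrate the majorant
  have hball : ∫ x, (ball (0 : EuclideanSpace ℝ (Fin 3)) δ).indicator
      (fun x => C * Mφ * ‖x‖ ^ (-(1 : ℝ))) x = C * Mφ * A * δ ^ 2 := by
    rw [integral_indicator measurableSet_ball, integral_const_mul,
      NewtonPotentialHolder.integral_ball_norm_rpow_neg (by norm_num) hδ0, hA]
    norm_num
    ring
  have hint : ∫ x, b x = C * Mφ * A * δ ^ 2 + ε / δ * I₁ := by
    rw [hb, hI₁, integral_add ((integrable_indicator_iff measurableSet_ball).2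
      ((NewtonPotentialHolder.integrableOn_ball_norm_rpow_neg (s := 1) (by norm_num) δ).const_mul (C * Mφ)))
      (hφi.norm.const_mul _), hball, integral_const_mul]
  rw [dist_zero_right]
  calc ‖∫ x, ⟪lam • g (lam • x), φ x⟫‖ ≤ ∫ x, b x := norm_integral_le_of_norm_le hbi hae
    _ = C * Mφ * A * δ ^ 2 + ε / δ * I₁ := hint
    _ ≤ η / 4 + η / 4 := by
        refine add_le_add hδη ?_
        rw [hε]
        calc η * δ / (4 * (I₁ + 1)) / δ * I₁ = η / 4 * (I₁ / (I₁ + 1)) := by field_simp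
          _ ≤ η / 4 * 1 := by
              refine mul_le_mul_of_nonneg_left ?_ (by positivity)
              rw [div_le_one (by positivity)]; linarith
          _ = η / 4 := mul_one _
    _ < η := by linarith

/-- **The `o(1/|x|)` rung of `NoSelfExcitedDynamo`.** Every bounded ancient mild solution `u` of
Navier–Stokes (`ν = 1`, duality form) on `ℝ³ × (−∞, 0)` with measurable slices, the pointwise Type-I
bound `‖u(t, x)‖ ≤ C/(‖x‖ + √(−t))`, and ONE slice decaying faster than `1/|x|` at spatial infinity,
`‖x‖‖u(t₀, x)‖ → 0` as `‖x‖ → ∞` for some `t₀ < 0`, has a.e.-zero slices (`farFieldRung` +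
`farFieldRung_blowdown_of_littleO`). Contrapositive (portrait): a counterexample to the crux satisfies
`limsup_{‖x‖→∞} ‖x‖‖u(t, x)‖ > 0` at EVERY time — its Type-I tail `C/‖x‖` is genuinely there. -/
theorem farFieldRung_of_littleOSlice :
    ∀ u : ℝ → EuclideanSpace ℝ (Fin 3) → EuclideanSpace ℝ (Fin 3),
      IsBoundedAncientMildSolution 1 u →
      (∀ t < 0, AEStronglyMeasurable (u t) volume) → (∃ C : ℝ, HasTypeIDecay C u) →
      (∃ t₀ : ℝ, t₀ < 0 ∧ ∀ ε : ℝ, 0 < ε → ∃ R : ℝ, ∀ x, R ≤ ‖x‖ → ‖x‖ * ‖u t₀ x‖ ≤ ε) →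
      ∀ t < 0, u t =ᵐ[volume] (0 : EuclideanSpace ℝ (Fin 3) → EuclideanSpace ℝ (Fin 3)) := by
  intro u hu hmeas hdec ho
  obtain ⟨C, hC⟩ := hdec
  obtain ⟨t₀, ht₀, ho⟩ := ho
  have hC0 : 0 ≤ C := hardness_typeI_const_nonneg hC
  have hbound : ∀ x, ‖x‖ * ‖u t₀ x‖ ≤ C := by
    intro x
    have hs : 0 < Real.sqrt (-t₀) := Real.sqrt_pos.2 (neg_pos.2 ht₀)
    have hden : 0 < ‖x‖ + Real.sqrt (-t₀) := by positivity
    calc ‖x‖ * ‖u t₀ x‖ ≤ ‖x‖ * (C / (‖x‖ + Real.sqrt (-t₀))) :=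
          mul_le_mul_of_nonneg_left (hC t₀ ht₀ x) (norm_nonneg _)
      _ ≤ (‖x‖ + Real.sqrt (-t₀)) * (C / (‖x‖ + Real.sqrt (-t₀))) :=
          mul_le_mul_of_nonneg_right (le_add_of_nonneg_right hs.le) (div_nonneg hC0 hden.le)
      _ = C := by field_simp
  exact farFieldRung u hu hmeas ⟨C, hC⟩
    ⟨t₀, ht₀, fun φ hφ => farFieldRung_blowdown_of_littleO hbound ho hφ⟩

end Summit.NavierStokesRegularity.NavierStokesRegularity.Theorems.NoSelfExcitedDynamo.Registered

end
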